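import Mathlib
import Summits.Langlands.Langlands.Theses.PhantomRMYoshida
import Summits.Langlands.Langlands.Theorems.PhantomRMYoshidaStableYoshidaCongruenceSector
import Summits.Langlands.Langlands.Theorems.PhantomRMYoshidaStableYoshidaCongruenceLocalConditionsTransfer
import Summits.Langlands.Langlands.Theorems.PhantomRMYoshidaStableYoshidaCongruenceResidualLattice
import Summits.Langlands.Langlands.Theorems.PhantomRMYoshidaStableYoshidaCongruenceOrdinaryFrameFp
import Summits.Langlands.Langlands.Theorems.PhantomRMYoshidaStableYoshidaCongruenceBWSector
import Summits.Langlands.Langlands.Theorems.PhantomRMYoshidaStableYoshidaCongruenceBlockModelFp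
import Summits.Langlands.Langlands.Theorems.PhantomRMYoshidaStableYoshidaCongruenceBL5Sector
import Summits.Langlands.Langlands.Theorems.PhantomRMYoshidaFaltingsTateModuleQGate
import Literature.NumberTheory.GaloisRepresentations.SerreWeight
import Literature.NumberTheory.GaloisRepresentations.ResidualPair
import Literature.NumberTheory.GaloisRepresentations.ResidualPairIntegrality
import Literature.AlgebraicGeometry.Motives.FaltingsAbelian
import Literature.AlgebraicGeometry.Motives.FaltingsFinitenessI

/-!
# Line `bilevel-one-five-anchor` — checked skeleton for the crux
`Summit.Langlands.Langlands.Theses.PhantomRMYoshida.StableYoshidaCongruence` (stmt-Langlands-13640)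

Planner crux-plan, round 2 (idea card `Cruxes/StableYoshidaCongruence/Ideas/bilevel-one-five-anchor.md`,
ideator 4; triage r2: pass ×2 — TRIAGE-r2-1.md, TRIAGE-r2-2.md; line card `Lines/bilevel-one-five-anchor.md`).

## The line (a p = 5 MOTIVIC SECTOR inside regime R4 of Disproof §5, via (1,5)-polarised weak bilevel moduli)

The crux asks, for every odd `p` and every eligible residual Yoshida pair `(σ̄, σ̄')` (irreducible,
`det = ε̄⁻¹`, non-conjugate, residually automorphic on `GL₂`) admitting SOME symplectic-`ε⁻¹`
Greenberg-`(0,0,1,1)` `p`-distinguished lift `ρ` (H5, possibly reducible), for an IRREDUCIBLE AUTOMORPHIC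
lift `ρ₀` of the same shape.  The crux's residual clause is a CHARACTERISTIC-POLYNOMIAL condition —
`charpoly ρ₀(Frob_v) ≡ charpoly σ̄ · charpoly σ̄'` — hence BLIND to the extension class of `ρ̄₀`
(`Matrix.charpoly_fromBlocks_zero₂₁`).  Round 1's motivic lines (`level-three-weierstrass-switch`,
`burkhardt-weddle-two-three-anchor`) realise `ρ₀ = H¹(B)` for a principally polarised `B/ℚ` with FULL level-`p`
structure of type `ρ̄`, whose twisted moduli space is rational only at `p = 3` (`A₂(p)`-twists are of general
type for `p ≥ 5`, Hulek–Sankaran; Disproof §5 R4 "no Diophantine supply").  THIS line changes the moduli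
problem: for a `(1,5)`-POLARISED abelian surface `(B, λ)` the kernel `K(λ) ⊂ B[5]` is a Galois-stable plane
with `det = ε̄`, `B[5]/K(λ) ≅ K(λ̂)`, and prescribing the Galois ISOMORPHISM CLASSES of `K(λ)` and of
`B[5]/K(λ)` — nothing about the extension — is Mukai's WEAK BILEVEL structure, whose moduli threefold
`𝒜^bl_5 = 𝒜^lev ×_{𝒜_{1,5}} 𝒜^col` is RATIONAL for `t ≤ 5` (Mukai 1999, quoted in Sankaran arXiv:math/0209192
§0 / Thm 1.1; `κ(𝒜^bl_6) ≥ 1`, Sankaran–Spandaw arXiv:math/0012202).  A `ℚ`-point of the `(τ'^*, τ^*)`-twist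
(weak approximation off a thin set: `End(B_ℚ̄) = ℤ`, good ordinary at `5`, good ordinary at `3` with
`ρ̄_{B,3} ↠ GSp₄(𝔽₃)` and `charpoly(Frob₃)` separable, `ρ̄_{B,3}` unramified at `2` off `4C ∪ 12C`) is MODULAR
by Boxer–Calegari–Gee–Pilloni 2025 Theorem 1 (arXiv:2502.20645 p. 3 = held-text Thm 420: "polarisation of
degree prime to 3" — a `(1,5)`-polarisation qualifies; hypotheses at `2` and `3` ONLY), and
`ρ₀ := H¹_ét(B_ℚ̄, ℚ̄₅)` is irreducible (Faltings + `End = ℤ`), symplectic-`ε⁻¹` (Weil pairing, rationally),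
Greenberg `(0,0,1,1)` at `5` (Serre–Tate), residually `σ̄ ⊕ σ̄'` (`(B[5]^*)^{ss} = K(λ̂)^* ⊕ K(λ)^*`),
residually `5`-distinguished (transferred from the H5 witness) and automorphic: `CruxAt 5` holds on the
sector, REDUCIBLE witnesses included.

THE SECTOR `BL5Sector` (`p = 5`; EACH of `σ̄`, `σ̄'` is `𝔽₅`-rational — a `(1,5)`-kernel is an
`𝔽₅`-plane, so the phantom-RM pairs `σ̄' = σ̄^(5)` over `𝔽₂₅` are NOT reached; both peu ramifiées at `5` —
good ORDINARY anchors `E × E'/ℚ₅`; both unramified at `2` and at `3` — BCGP Thm 1's engine primes).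
ORDINARY-SHAPEDNESS at `5` is NOT assumed: it is DERIVED from H5 by the landed round-1 stubs
(`stub_residualLattice` + `stub_ordinaryFrameFp`, Disproof §4 "H5 certifies the ordinary p-distinguished pair"),
and NO distinguishedness hypothesis enters the lever at all (triage r2-1 (i): BCGP's 3-distinguishedness is a
char-0 property of `B` produced inside the lever; residual 5-distinguishedness of `ρ₀` is transferred from the
witness by the landed `stub_charpolyCongruence` + `stub_distinguishedTransferLocal`).

## Shape (data flow of `StableYoshidaCongruence_of`; sorry-free glue at the end)

`crux_iff` (LTWS, `Iff.rfl`) ↦ `CruxAt p k red σ σ'`; classical split: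
* Burkhardt–Weddle sector (`p = 3`, LANDED round 1): `stub_sectorFacts` + the landed
  `stub_bwSectorModuloFacts` (p117182) ↦ `CruxAt`.
* bilevel sector (`p = 5`, THIS line): `stub_blockModelFp` (Stub 1: `𝔽₅`-descent of the pair to a
  BLOCK-DIAGONAL `GL₄(𝔽₅)`-model `ρb = τ ⊕ τ'`) ↦ landed BW Stubs 3–5 give `IsOrdinaryFlatAt 5 v ρb` and
  unramifiedness at `2`, `3` ↦ `stub_bilevelFiveSwitch` (Stub 2, THE LEVER: a modular abelian surface `B/ℚ`,
  good ordinary at `5`, `End_ℚ = ℤ`, `H¹(B, ℚ̄₅)` congruent to `τ ⊕ τ'`) ↦ landed p-generic dictionary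
  (`framedH1`, `isSymplectic_framedH1`, `stub_tateModuleIrreducible`, `stub_tateModuleGreenberg`,
  `stub_charpolyCongruence`, `stub_distinguishedTransferLocal`) + the in-file generic-`p` residual-pair lemma
  `hasResidualPair_of_congruence` ↦ `CruxAt` (the sorry-free SECTOR THEOREM `cruxAt_bl5Sector`).
* off both motivic sectors: `stub_offMotivicSectors` (Stub 4, the honest open remainder; NOT claimed).

RESHAPE (lead a2, cycle 1, 2026-08-16): Stub 1 `stub_blockModelFp` LANDED (p128445) and is imported together
with `IsBlockPair` / `DetCondFp`; the sector theorem is registered as Stub 5 `stub_bl5SectorModuloLever` —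
facts `FaltingsFinitenessI → ordinaryReduction_tateModule_filtration → weilPairing_rationalTateModule` (route-choice
RCHOICE-7 rewire: Faltings Satz 3/4 derived in-proof) → THE LEVER (Stub 2's statement, inlined) → `BL5Sector`
(inlined) → `CruxAt`, LANDED as `Theorems/…BL5Sector.lean` (p128938) and imported; `cruxAt_bl5Sector` = Stub 5 fed
with Stub 2.  OPEN (the only sorries of this file): Stub 2 (lever, open on paper at K1b — line DEAD here, see
`Lines/bilevel-one-five-anchor-dead.md`), Stub 3 (named facts), Stub 4 (remainder = the crux off both sectors).

## Disproof used (Cruxes/StableYoshidaCongruence/Disproof.lean, cdisprove cycle 3, read 2026-08-16)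

* §2 `exists_cuspForm_of_not_crux`: no `_false_without_H` theorem exists — nothing to honour by name.
* §4 `loadBearing`: H5 (`∃ ρ, Sh ρ`) is consumed exactly where §4 says it can be — for the ordinary
  ORIENTATION of `σ|Γ_5`, `σ'|Γ_5` (`stub_residualLattice` → `stub_ordinaryFrameFp` feeding Stub 2's
  `IsOrdinaryFlatAt` hypothesis) and for residual distinguishedness of `ρ₀` (`stub_distinguishedTransferLocal`);
  H1 (`AutGL2`) is decoration (§3.5) and is threaded only to Stub 4; H2–H4 feed Stub 1 (irreducibility, `det`)
  and Stub 4.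
* §3.2 Irr′-trap avoided: no stub takes an irreducible witness; the sector is cut out by conditions on the PAIR.
* §5: R2 = the `p = 3` branch (landed); THIS line contests R4 ("no Diophantine supply") at `p = 5` and only
  there; R1/D1/R4(`p ≥ 7`)/D-residue ⊂ Stub 4.  §6 honoured: the "+1" is supplied by a MOTIVE.
* `cruxAt_of_automorphic_lift` is the shape of `cruxAt_bl5Sector`'s conclusion; `cruxAt_comm` (§3.6) lets the
  `(1,5)`-kernel constituent be either of `σ̄`, `σ̄'` (Stub 2 is symmetric anyway).
* No `Negative/` lemma has landed for this crux (nothing to import); negatives index: 1 unrelated entry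
  (K3 Kuga–Satake, stmt-Langlands-3797).
-/

set_option linter.dupNamespace false
set_option linter.unusedVariables false

noncomputable section

open CategoryTheory IsDedekindDomain Polynomial
open scoped NumberField
open Literature.NumberTheory.GaloisRepresentations Literature.NumberTheory.Automorphic
open Literature.AlgebraicGeometry.Motives (AbelianVariety)
open Literature.NumberTheory.DiophantineGeometry (weilPairing_rationalTateModule
  ordinaryReduction_tateModule_filtration bcgp_switch_exists_modular_abelianSurface)
open Summit.Langlands.Langlands.Theses.PhantomRMYoshida
open Summit.Langlands.Langlands.Theorems.PhantomRMYoshida (faltings_tate_bijective_of_finitenessI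
  isSemisimpleRepresentation_rationalTateRep_of_finitenessI)
open Summit.Langlands.Langlands.Cruxes.StableYoshidaCongruence.LevelThreeWeierstrassSwitch
open Summit.Langlands.Langlands.Cruxes.StableYoshidaCongruence.BurkhardtWeddleTwoThreeAnchor

namespace Summit.Langlands.Langlands.Cruxes.StableYoshidaCongruence.BilevelOneFiveAnchor

/-! ## Vocabulary — imported from the landed LTWS / BW files (`Sh`, `AutGL2`, `AutGL4`, `DetCond`, `NonConj`,
`CruxAt`, `crux_iff`, `epsBar`, `toK`, `IsModelOf`, `IsOrdinaryFlatAt`, `TateFrame`, `EndTrivial`); new here: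
the two sector predicates, `IsBlockPair`, `DetCondFp`. -/

section Vocabulary

variable (p : ℕ) [Fact p.Prime] (k : Type) [Field k] [CharP k p] [TopologicalSpace k] [DiscreteTopology k]

/-- **The Burkhardt–Weddle sector** (round 1, LANDED: `stub_bwSectorModuloFacts`, p117182), verbatim the
inlined hypothesis of that theorem: `p = 3`; `charpoly σ · charpoly σ'` is `𝔽_p`-rational; `σ`, `σ'` peu
ramifiées at `v ∣ p`; unramified at `v ∣ 2` with `P₁ P₂ ≠ (X² ± X + 2)²`. -/
def BWSector (σ σ' : FramedGaloisRep ℚ k 2) : Prop :=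
  p = 3 ∧
  (∀ g : Field.absoluteGaloisGroup ℚ, ∃ Q : Polynomial (ZMod p),
      Q.map (ZMod.castHom (dvd_refl p) k) = FramedRep.charpoly σ g * FramedRep.charpoly σ' g) ∧
  (∀ v : HeightOneSpectrum (𝓞 ℚ), ((p : ℕ) : 𝓞 ℚ) ∈ v.asIdeal →
      ModPGaloisRep.IsPeuRamifie (σ.toLocal v) ∧ ModPGaloisRep.IsPeuRamifie (σ'.toLocal v)) ∧
  (∀ v : HeightOneSpectrum (𝓞 ℚ), ((2 : ℕ) : 𝓞 ℚ) ∈ v.asIdeal →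
      σ.IsUnramifiedAt v ∧ σ'.IsUnramifiedAt v ∧
      ∃ P₁ P₂ : Polynomial k, σ.HasFrobCharpolyAt v P₁ ∧ σ'.HasFrobCharpolyAt v P₂ ∧
        P₁ * P₂ ≠ (X ^ 2 + X + C 2) ^ 2 ∧ P₁ * P₂ ≠ (X ^ 2 - X + C 2) ^ 2)

/-- **The bilevel-`5` sector** of THIS line: `p = 5`; EACH constituent is `𝔽_p`-RATIONAL (every
`charpoly σ(g)` and every `charpoly σ'(g)` comes from `𝔽_p[X]` — so each descends to `GL₂(𝔽₅)` by
Deligne–Serre; the phantom-RM pairs `σ' ≅ σ^(5)` are EXCLUDED: a `(1,5)`-kernel is an `𝔽₅`-plane);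
`σ|Γ_{ℚ_v}`, `σ'|Γ_{ℚ_v}` PEU RAMIFIÉES at `v ∣ p` (good ordinary anchors at `5`); `σ`, `σ'` unramified
at the engine primes `2` and `3` of BCGP2025 Theorem 1.  NO ordinary / distinguished hypothesis: the
ordinary orientation at `5` is derived from the crux's H5 (landed Stubs 4–5 of the BW line). -/
def BL5Sector (σ σ' : FramedGaloisRep ℚ k 2) : Prop :=
  p = 5 ∧
  (∀ g : Field.absoluteGaloisGroup ℚ, ∃ Q₁ Q₂ : Polynomial (ZMod p),
      Q₁.map (ZMod.castHom (dvd_refl p) k) = FramedRep.charpoly σ g ∧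
      Q₂.map (ZMod.castHom (dvd_refl p) k) = FramedRep.charpoly σ' g) ∧
  (∀ v : HeightOneSpectrum (𝓞 ℚ), ((p : ℕ) : 𝓞 ℚ) ∈ v.asIdeal →
      ModPGaloisRep.IsPeuRamifie (σ.toLocal v) ∧ ModPGaloisRep.IsPeuRamifie (σ'.toLocal v)) ∧
  (∀ v : HeightOneSpectrum (𝓞 ℚ), ((2 : ℕ) : 𝓞 ℚ) ∈ v.asIdeal →
      σ.IsUnramifiedAt v ∧ σ'.IsUnramifiedAt v) ∧
  (∀ v : HeightOneSpectrum (𝓞 ℚ), ((3 : ℕ) : 𝓞 ℚ) ∈ v.asIdeal →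
      σ.IsUnramifiedAt v ∧ σ'.IsUnramifiedAt v)

end Vocabulary

/-! ## Stub 1 — `𝔽_p`-descent of an `𝔽_p`-rational pair to a BLOCK-DIAGONAL model: LANDED

`stub_blockModelFp` (with the vocabulary `IsBlockPair`, `DetCondFp`) is imported from the landed
`Theorems/PhantomRMYoshidaStableYoshidaCongruenceBlockModelFp.lean` (p128445, lead a2 wave 1, 2026-08-16):
Deligne–Serre 6.13 twice, block sum, Brauer–Nesbitt conjugacy, irreducibility and determinants descended
along `𝔽_p ↪ k`. -/

/-! ## Stub 2 — THE LEVER: the bilevel-`5` switch lands on a modular abelian surface (open; XL⁺) -/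

/-- **Stub 2 (`stub_bilevelFiveSwitch`; THE LEVER — the card's K1 + K2 + BCGP2025 Theorem 1; OPEN at K1).**
Typed in the exact OUTPUT format of the landed `p = 3` fact `bcgp_switch_exists_modular_abelianSurface`
(arXiv:2502.20645 Lemma 9.4.2 + Thm 8.3.2) with `3 ↦ 5` and the `GSp₄(𝔽₃)`-model replaced by a BLOCK-DIAGONAL
pair.  INPUT: `p = 5`; `τ, τ' : Γ_ℚ → GL₂(𝔽₅)` irreducible with `det = ε̄⁻¹`, `ρb = τ ⊕ τ'`; `ρb|Γ_{ℚ₅}`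
ordinary-with-unramified-sub and peu ramifié (LTWS `IsOrdinaryFlatAt 5 v ρb`: each constituent is the
`5`-torsion dual of a good ORDINARY elliptic curve over `ℚ₅` — the Serre–Tate anchor at `5`); `ρb` unramified
at `2` and `3`.  OUTPUT: an abelian surface `B/ℚ` (`dim = 2`) with good ordinary reduction at `5`,
`End_ℚ(B) = ℤ·id`, and for the framed `r = H¹_ét(B_ℚ̄, ℚ̄₅)` (dual basis of any `ℚ₅`-basis of `V₅ B`) every
`det(X − r(g))` lies in `ℤ₅[X]` and reduces mod `5` to `det(X − τ(g)) det(X − τ'(g))`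
(`(B[5]^*)^{ss} ≅ τ ⊕ τ'`), and `B` is MODULAR in the summit's a.e. L-normalised form on `GL₄(𝔸_ℚ)`.
MECHANISM (card bilevel-one-five-anchor; NOT in print as a whole): (K1a) the `(τ'^*)`-twist of the LEVEL
threefold `𝒜^lev_{1,5} ≅` open of `ℙΓ(F_HM) ≅ ℙ³` (Horrocks–Mumford; `N = H₅ ⋊ SL₂(𝔽₅)` acts LINEARLY on
`Γ(F_HM)`, so the twist is `ℙ³_ℚ` by Hilbert 90); (K1b, the HARDEST sub-step) descent of Mukai's rationality
of the weak-bilevel threefold `𝒜^bl_5` (Sapporo 1999, via Sankaran math/0209192 §0, Thm 1.1; colevel = the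
degree-60 `PSL₂(𝔽₅)`-cover) to the `(τ'^*, τ^*)`-twist — at least `ℚ`-UNIRATIONALITY with weak approximation
at `{2, 3, 5, ∞}` — anchored at the smooth `ℚ`-point `[E × E', 𝒪(1) ⊠ 𝒪(5)]` on Mukai's quadric
`H₁ ≅ X(τ'^*) × X(τ^*) ≅ ℙ¹ × ℙ¹` (Shepherd-Barron–Taylor 1997: every `GL₂(𝔽₅)`-representation with cyclotomic
determinant is `E[5]`); (K2) weak approximation + Hilbert irreducibility on that unirational family: local
anchors at `2` (all 15 Frobenius trace-pairs mod 5 realised with `ρ̄₃` unramified off `4C ∪ 12C`, 13 by good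
reduction, `(1,3),(2,4)` by Tate factors with `15 ∣ v₂(q)` — COMPUTE-bilevel-local-solvability.md, re-run by
triage r2-1), at `3` (all 15 pairs by GOOD ORDINARY `3`-distinguished Weil polynomials), at `5` (Serre–Tate
products), `ρ̄_{B,3} ↠ GSp₄(𝔽₃)` (geometric mod-3 monodromy of the bilevel-5 family is full: level prime to
3) and `End(B_ℚ̄) = ℤ` off thin sets, `charpoly(Frob₃)` separable (open condition); then (Thm 1) BCGP2025
Theorem 1 VERBATIM (p. 3: polarisation of degree prime to `3` — the `(1,5)`-polarisation; `ρ̄_{B,3}`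
surjective; `ρ̄_{B,3}|G_{ℚ₂}` unramified with `charpoly(Frob₂) ≠ (x² ± x + 2)²`; good ordinary at `3` with
`charpoly(Frob₃)` without repeated roots ⇒ cuspidal `π` on `GL₄/ℚ` with `L(s, H¹(B)) = L(s, π)`), read for the
`5`-adic member of the compatible system.  WHY IT MIGHT FAIL: K1b is open arithmetic geometry (twists of rational
moduli threefolds are "almost never" `ℚ`-rational, BCGP §1.2 / Calegari–Chidambaram, though `P(A[3])` stayed
rational; Mukai-equivariance of the birational map `𝒜^bl_5 ⤏ ℙ(linear rep)` would settle it by Hilbert 90 +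
BCGP Lemma 415, exactly as `P(ρ̄)` at `3` — [Muk] not held, want acq-06343); K2(i) a `(1,5)`-polarised member
with the prescribed Frobenius-stable kernel must exist in the two non-product local isogeny classes at `2` and at
`3` (finite Howe-type check, open); the L-normalised `GSp₄ → GL₄` dictionary debt is shared with every line of
the route.  A vendored version splits as: Diophantine supply (K1+K2, needs `AbelianVariety` polarisation /
torsion-module vocabulary absent from the tree) + BCGP Thm 1 as a named fact.
[cite: BoxerCalegariGeePilloni2025, Theorem 1 of the introduction (p. 3; = Thm 420, p. 136 of the held text), Lemma 9.4.1 (approximation template), Def. 1.8.8, §1.8.10–1.8.12 (arXiv:2502.20645)]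
[cite: Sankaran2003 (arXiv:math/0209192), §0 and Thm 1.1; SankaranSpandaw2002 (arXiv:math/0012202), §0;
Mukai1999Sapporo; HorrocksMumford1973; ShepherdBarronTaylor1997 (doi:10.1090/s0894-0347-97-00226-9)] -/
theorem stub_bilevelFiveSwitch :
    ∀ (p : ℕ) [Fact p.Prime], p = 5 →
      ∀ (τ τ' : FramedGaloisRep ℚ (ZMod p) 2) (ρb : FramedGaloisRep ℚ (ZMod p) 4),
      IsBlockPair τ τ' ρb → τ.toGaloisRep.IsIrreducible → τ'.toGaloisRep.IsIrreducible →
      DetCondFp p τ τ' →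
      (∀ v : HeightOneSpectrum (𝓞 ℚ), ((p : ℕ) : 𝓞 ℚ) ∈ v.asIdeal → IsOrdinaryFlatAt p v ρb) →
      (∀ v : HeightOneSpectrum (𝓞 ℚ), ((2 : ℕ) : 𝓞 ℚ) ∈ v.asIdeal → ρb.IsUnramifiedAt v) →
      (∀ v : HeightOneSpectrum (𝓞 ℚ), ((3 : ℕ) : 𝓞 ℚ) ∈ v.asIdeal → ρb.IsUnramifiedAt v) →
      ∃ B : AbelianVariety ℚ,
        B.dim = 2 ∧
        (∀ v : HeightOneSpectrum (𝓞 ℚ), ((p : ℕ) : 𝓞 ℚ) ∈ v.asIdeal → B.HasGoodOrdinaryReductionAt v) ∧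
        EndTrivial B ∧
        ∀ (b : Module.Basis (Fin 4) ℚ_[p] (B.rationalTateModule p))
          (r : FramedGaloisRep ℚ (PadicAlgCl p) 4),
          TateFrame p B b r →
          (∀ g : Field.absoluteGaloisGroup ℚ, ∃ P : Polynomial ℤ_[p],
              P.map (algebraMap ℤ_[p] (PadicAlgCl p)) = FramedRep.charpoly r g ∧
              P.map (PadicInt.toZMod (p := p)) = FramedRep.charpoly ρb g) ∧
          ∀ (hcpt : isCompact_glFiniteIntegralLevel 4 ℚ) (ι : PadicAlgCl p ≃+* ℂ),
            ∃ π : CuspidalAutomorphicRepData 4 ℚ hcpt, π.1.IsLAlgebraic ∧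
              ∀ᶠ v : HeightOneSpectrum (𝓞 ℚ) in Filter.cofinite,
                ∃ a : Multiset ℂ, π.1.HasSatakeParamAt v a ∧ r.IsUnramifiedAt v ∧
                  r.HasFrobCharpolyAt v (arithFrobPolyOfSatake ι v.residueCard 1 a) := by
  sorry

/-! ## Stub 3 — the PUBLISHED FACTS consumed on the two motivic sectors, bundled (not a worker task) -/

/-- **Stub 3 (`stub_sectorFacts`; published theorems, ONE registered obligation — verbatim the BW line's
registered `stub_sectorFacts`, so the two motivic sectors share it).**  (F1) FALTINGS through the route's
named-fact gate item `FaltingsFinitenessI` (stmt-Langlands-15084; Satz 3/4 over `ℚ` follow IN THE TREE: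
`faltings_tate_bijective_of_finitenessI`, `isSemisimpleRepresentation_rationalTateRep_of_finitenessI`,
`Theorems/PhantomRMYoshidaFaltingsTateModuleQGate.lean`) — irreducibility of `H¹(B)` for `End_ℚ(B) = ℤ`;
(F2) SERRE–TATE ordinary filtration `ordinaryReduction_tateModule_filtration` (p86833) — Greenberg `(0,0,1,1)`
at `5`; (F3) the BCGP `2`–`3` switch `bcgp_switch_exists_modular_abelianSurface` (p92170) — used ONLY on the
`p = 3` branch (landed `stub_bwSectorModuloFacts`); (F4) WEIL pairing `weilPairing_rationalTateModule`
(p86824) — symplectic-`ε⁻¹`.  Discharged exactly by `_holds` proofs of the three Literature facts and the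
route item; theorems in print, not line-sized.
[cite: Faltings1983Endlichkeit, §5 Satz 3–4, §6 Satz 5–6; SerreTate1968GoodReduction, §1;
BoxerCalegariGeePilloni2025, Lemma 9.4.2, Thm. 8.3.2, Thm. 9.5.2; Milne1986AbelianVarieties, §16] -/
theorem stub_sectorFacts :
    FaltingsFinitenessI ∧ ordinaryReduction_tateModule_filtration ∧
      bcgp_switch_exists_modular_abelianSurface ∧ weilPairing_rationalTateModule := by
  sorry

/-! ## Stub 4 — the HONEST REMAINDER: the crux off BOTH motivic sectors (open; not claimed) -/

/-- **Stub 4 (`stub_offMotivicSectors`, OPEN — the remainder this line does NOT attack).**  Off the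
Burkhardt–Weddle sector (`p = 3`, landed) AND off the bilevel-`5` sector: every odd `p ≥ 7` (bilevel-`t`
has `κ ≥ 1` from `t = 6` on, Sankaran–Spandaw; `A₂(p)`-twists of general type — regime R4 of Disproof §5
with NO motivic supply of any known kind); at `p = 5` the pairs that are not constituent-wise `𝔽₅`-rational
(incl. the phantom-RM pairs `σ̄' = σ̄^(5)`), très ramifié at `5`, or ramified at `2` or `3`; at `p = 3` the
BW leftovers (très ramifié / ramified at `2` / `4C ∪ 12C` / not `𝔽₃`-rational); the D-residue.  Strictly
WEAKER than the crux but carrying all of its generic difficulty: expected dimension `-1` independently of the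
level (Disproof §6), no endoscopic → stable weight-`(2,2)` engine in print (Sorensen2006 regular weight,
Sorensen2009 SK, LemmaOchiai2023 weight ≥ 4, BDSP2012 `k′−k ≥ 6`, HsiehPalvannan2025 / Deo–Palvannan 2026
rigidity direction); a RIGID PAIR (Disproof §3.4) off the sectors refutes it and the crux with it.  Triage r2
(both seats) and the round-1 dead notes: this is `promote-stub` / planner-split material (sector children
A₃ = BW, A₅ = this line, remainder B), or the tenure restatement to `Irr'` (Disproof `closes_irr'`).  Size: open (XL⁺).
[cite: BoxerCalegariGeePilloni2025, Remark 9.4.4; HulekSankaran2002; SankaranSpandaw2002 (arXiv:math/0012202);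
Sorensen2006; Sorensen2009; LemmaOchiai2023; HsiehPalvannan2025; DeoPalvannan2026 (arXiv:2602.20737)] -/
theorem stub_offMotivicSectors :
    ∀ (p : ℕ) [Fact p.Prime], p ≠ 2 → ∀ (k : Type) [Field k] [CharP k p] [IsAlgClosed k]
      [TopologicalSpace k] [DiscreteTopology k] (red : Valued.integer (PadicAlgCl p) →+* k)
      (σ σ' : FramedGaloisRep ℚ k 2),
      ¬ BWSector p k σ σ' → ¬ BL5Sector p k σ σ' → CruxAt p k red σ σ' := by
  sorry

/-! ## Dictionary lemma `hasResidualPair_of_congruence` (generic `p`) and Stub 5: LANDED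

Both are imported from `Theorems/PhantomRMYoshidaStableYoshidaCongruenceBL5Sector.lean` (p128938, lead a2 cycle 1):
`stub_bl5SectorModuloLever` — the bilevel-`5` SECTOR THEOREM modulo the lever (registered reshape stub; facts interface
`FaltingsFinitenessI → ordinaryReduction_tateModule_filtration → weilPairing_rationalTateModule`, then THE LEVER = Stub 2's
statement inlined, then `BL5Sector` inlined) — and the generic-`p` residual-pair lemma it uses. -/

/-! ## The bilevel SECTOR THEOREM (sorry-free glue): the crux on `BL5Sector`, from Stubs 1, 2, 5 and the facts -/

/-- **The crux on the bilevel-`5` sector, modulo three published facts and the lever Stub 2** (the card's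
K3 `BL5Reduction`): Stub 5 fed with Stub 2.  Interface `FaltingsFinitenessI → ordinaryReduction_tateModule_filtration
→ weilPairing_rationalTateModule → …` exactly as the landed `stub_bwSectorModuloFacts` (route-choice RCHOICE-7). -/
theorem cruxAt_bl5Sector (hFI : FaltingsFinitenessI) (hST : ordinaryReduction_tateModule_filtration)
    (hWeil : weilPairing_rationalTateModule)
    (p : ℕ) [Fact p.Prime] (hp : p ≠ 2) (k : Type) [Field k] [CharP k p] [IsAlgClosed k]
    [TopologicalSpace k] [DiscreteTopology k] (red : Valued.integer (PadicAlgCl p) →+* k)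
    (σ σ' : FramedGaloisRep ℚ k 2) (hsec : BL5Sector p k σ σ') :
    CruxAt p k red σ σ' :=
  stub_bl5SectorModuloLever hFI hST hWeil stub_bilevelFiveSwitch p hp k red σ σ' hsec

/-! ## Glue (sorry-free): the crux from the two motivic sectors and the open remainder -/

/-- **`StableYoshidaCongruence` from the line `bilevel-one-five-anchor`.**  Regime split: on the
Burkhardt–Weddle sector (`p = 3`) the LANDED round-1 sector theorem `stub_bwSectorModuloFacts` (p117182);
on the bilevel-`5` sector THIS line's sector theorem `cruxAt_bl5Sector` (landed Stub 1 + Stub 5, fed with the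
lever Stub 2 + facts); off both, Stub 4 (the honest open remainder).  Sorries left: Stub 2 (the lever, open at
K1b), Stub 3 (published facts), Stub 4 (the open remainder). -/
theorem StableYoshidaCongruence_of : StableYoshidaCongruence := by
  refine crux_iff.mpr fun p _ hp k _ _ _ _ _ red σ σ' => ?_
  obtain ⟨hFI, hST, hBCGP, hWeil⟩ := stub_sectorFacts
  by_cases hbw : BWSector p k σ σ'
  · exact stub_bwSectorModuloFacts hFI hST hBCGP hWeil p hp k red σ σ' hbw
  by_cases hbl : BL5Sector p k σ σ'
  · exact cruxAt_bl5Sector hFI hST hWeil p hp k red σ σ' hbl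
  · exact stub_offMotivicSectors p hp k red σ σ' hbw hbl

end Summit.Langlands.Langlands.Cruxes.StableYoshidaCongruence.BilevelOneFiveAnchor

end
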